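import Literature.MathematicalPhysics.QuantumFieldTheory.Balaban1983to89.Beta.EntrywiseVolumeLimit
import Literature.MathematicalPhysics.QuantumFieldTheory.Balaban1983to89.Beta.CoordCubePoincare
import Literature.MathematicalPhysics.QuantumFieldTheory.Balaban1983to89.B12Decay510Window
import Literature.MathematicalPhysics.QuantumFieldTheory.Balaban1983to89.QGQInverse

/-!
# Bałaban's one-step block-averaging operator `T = −Δ + a Q*Q` on the unit lattice `ℤ^d` (blocks of side
# `L = n + 1 ≥ 2`): finite range, block-periodicity, and UNIFORM COERCIVITY OF EVERY FINITE PRINCIPAL SUBMATRIX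
# from the blockwise Poincaré inequality (`Beta.RemainderKernelBlockAveraging`)

statement-level skeleton of published theorems with citation tags; proofs where landed; nothing here is a claim
about the Yang–Mills mass gap.

HONEST FRAMING (cell rule).  Bookkeeping for the k-uniform remainder chain of row (D4) (`RemainderConst` ⇐ ONE
`ChainTFac190` instance, `Beta.RemainderDecay190`); discharges NOTHING of `BetaPertH`; NOT B12 Thm 2, NOT the continuum
limit, NOT Clay.  Unit `b2b-balaban-beta-an4` gen 99 (BINDER row D4 OWNER; cell pub-balaban).  Imports
`Beta.EntrywiseVolumeLimit` (gen 9: `Kernel₂`, `IsPeriodic₂`, `HasRange`, `imageShift`), `Beta.CoordCubePoincare` (pv23: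
`stepUp`, **`coercive_lap_blocks_of_charts`** = `BlockPoincare.poincare_cube` + `coercive_lap_blocks` in chart form),
`B12Decay510Window` (`l1_sub_comm`) and `QGQInverse` (reader r1: `Coercive`) ONLY, all BY NAME and all long built;
nothing edited, no engine re-proved.  [folklore] — a composition, no new idea.

WHY.  Gen 98's `Beta.RemainderKernelGreenCoercive.exists_green_of_coercive_hasRange` (p379892) turns «finite range +
bounded entries + every finite principal submatrix `γ`-coercive» into a two-sided, exponentially decaying, block-periodic
`ℤ^d` Green's function WITHOUT smallness; its companion `RemainderKernelGreenLattice` supplies the coercivity for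
`−Δ + m²` by a diagonal-dominance count and names as NOT DONE «`−Δ + aQ*Q` WITHOUT mass (coercive by a blockwise
Poincaré inequality, not by a diagonal-dominance count)».  THIS FILE supplies exactly that coercivity, for the operator
by its ENTRIES (a HYPOTHESIS `hT` on an abstract `T : Kernel₂ d`, so any definition plugs in):
`T(x,y) = 2d·1[x = y] − 1[|x − y|₁ = 1] + (a∕L^d)·1[x_i ∕ L = y_i ∕ L ∀ i]` (Euclidean division), i.e. `−Δ + a Q*Q` with
`Q` the average over the blocks `L·b + {0,…,n}^d` and `Q*Q` the orthogonal projection onto block-constant functions —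
the unit-lattice, scalar, ONE-step form of the operator whose inverse is `G₀ = (Δ + aQ*Q)⁻¹` of [5] (1.132)–(1.134)
(there for vector fields, on the `η = L^{−k}`-lattice, with the form (1.69)):

* §1  lattice geometry: `|e_μ|₁ = 1`, vectors of `ℓ¹`-length one are `±e_i`, a site has at most `2d` nearest neighbours
  in any finset (`sum_indicator_nn_le`; gen 98's count, restated on built imports).
* §2  the chart `(b, y) ↦ L·b + y` (`b ∈ ℤ^d`, `y ∈ {0,…,n}^d`): block by `∕ L`, digit by `% L`, injective, onto, and an
  internal step `y ↦ stepUp y μ` (`y_μ ≠ n`) is the lattice step `+ e_μ` (`chart_stepUp`).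
* §3  `T` has range `L` (`hasRange_blockAvg`), entries `≤ 2d + 1 + a`, and is jointly `L`-periodic (`isPeriodic₂_blockAvg`;
  hence `s`-periodic for every multiple `s` of `L` by `IsPeriodic₂.of_dvd`).
* §4  **`form_lower_of_charts`** — the engine: on any finite patch `ι ↪ ℤ^d` made of full blocks charted by cubes,
  `min(2∕(n(n+1)), a)·‖ω‖² ≤ Σ_{j,k} ω_j T(Φ j, Φ k) ω_k`.  The Laplacian part of `T` restricted to the patch is the graph
  Laplacian `lap c` of the induced nearest-neighbour graph (conductance `1`) PLUS the boundary diagonal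
  `2d − deg ≥ 0` (§1), the block part is `Σ_b (a∕|b|)·1_b ⊗ 1_b` with `|b| = L^d`, and pv23's
  `coercive_lap_blocks_of_charts` (Poincaré constant `n(n+1)∕2` per cube `{0,…,n}^d`, bonds = ordered nearest-neighbour
  pairs `Φ k = Φ j + e_μ`, listed once, never reversed) gives the constant `min(1∕P, a)`.
* §5  **`form_blockAvg`**: for EVERY finset `t ⊂ ℤ^d` and every `f`,
  `min(2∕(n(n+1)), a)·Σ_{x∈t} f(x)² ≤ Σ_{x,y∈t} f(x)T(x,y)f(y)` (extend `f` by zero to the union of the blocks meeting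
  `t`, a charted patch); **`coercive_blockAvg`**: every finite principal submatrix `(T(i,j))_{i,j∈s}` is
  `min(2∕(n(n+1)), a)`-coercive in r1's sense — the hypothesis `hco` of `exists_green_of_coercive_hasRange`, uniformly
  in `s`; `coerciveConst_pos`; **`form_blockAvg_meshUniform`**: in Bałaban's `η = 1∕L` scaling (`L²·T = −Δ^η + a_η Q*Q`,
  `a_η = L²a`) the constant is `min(2, a_η)` — pv23's torus constant (`TorusG0Decay.coercive_torus`), here for EVERY
  finite patch of `ℤ^d`, uniformly in the mesh; `form_blockAvg_side` ∕ `coercive_blockAvg_side`: the same with the block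
  side `L ≥ 2` as the parameter (constant `min(2∕((L−1)L), a)`); `form_blockAvg_massive`: `−Δ + aQ*Q + m²` has the form
  constant `min(2∕(n(n+1)), a) + m²`.
The short corollary «`G = T⁻¹` exists on `ℤ^d`, two-sided, `Decay₂ G (2∕min(2∕(n(n+1)),a)) κ` for some `κ > 0`,
jointly `L`-periodic» is `exists_green_of_coercive_hasRange (hasRange_blockAvg hT) (coerciveConst_pos ha hn)
(abs_blockAvg_le hT ha.le) (coercive_blockAvg hT ha.le hn)` + `isPeriodic₂_blockAvg`; it is filed separately
(`Beta.RemainderKernelGreenBlockAveraging`) only because that parent is not yet built on the farm.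
WHAT IS *NOT* DONE: (i) the FORM constant is mesh-uniform (`form_blockAvg_meshUniform`), but the DECAY RATE that the
finite-range Combes–Thomas bound of `RemainderKernelGreenCoercive` produces from it degrades with the block side (the
block term is treated as a generic range-`L` perturbation), so NOTHING uniform in `k` — [5] Prop. 1.2's `δ₀` «depending
on `d` only» — is obtained downstream; (ii) scalar fields only: no vector
fields, no `dPd*` term of (1.69), no covariant (gauge-field dependent) Laplacian, no averaging-constrained subspace;
(iii) nothing of [5] is asserted or valued.  Row D4 class UNCHANGED (instance 0∕1; critical-path width 0 = NODE O;
D4 DISCHARGE NO DATE).  No `def`, no named fact, no `sorry`, standard axioms.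
HONEST DEPENDENCY: continuum YM on T⁴ ⇐ BetaPertH ∧ nine spine estimates (0/9 proved); BetaPertH ⇐ (D1) ∧ (D4) ∧
CAP+tail; G-an2-4 gates asym, D1 and NE2/3/4.

Sources: [5] = T. Bałaban, Commun. Math. Phys. **95** (1984) 17–40 [Balaban1984PropagatorsI]: (1.18) p. 20 (the block
averaging `Q_k` over the blocks `B^k(y)`), (1.69) p. 29 (the quadratic form `⟨A, ΔA⟩ + … + a⟨A, Q*QA⟩`), (1.132)–(1.134)
p. 39 (`G₀ = (Δ + aQ*Q)⁻¹`, «Proposition 1.2 for the operator `G₀`»), Prop. 1.2 (1.110) p. 35 (context: the uniform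
decay this file does NOT reach); discrete Poincaré inequality on cubes: D. Bakry, I. Gentil, M. Ledoux, *Analysis and
Geometry of Markov Diffusion Operators* (2014) Prop. 4.3.1 (via `Beta.BlockPoincare`, pv23).
-/

namespace Literature.MathematicalPhysics.QuantumFieldTheory.Balaban1983to89.Beta.RemainderKernelBlockAveraging

open Literature.MathematicalPhysics.QuantumFieldTheory.Balaban1983to89
open Literature.MathematicalPhysics.QuantumFieldTheory.Balaban1983to89.B12Sec2to5 (l1 l1_nonneg abs_coord_le_l1)
open Literature.MathematicalPhysics.QuantumFieldTheory.Balaban1983to89.B12Decay510Window (l1_sub_triangle l1_sub_comm)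
open Literature.MathematicalPhysics.QuantumFieldTheory.Balaban1983to89.Beta
  (Kernel₂ IsPeriodic₂ HasRange imageShift imageShift_apply l1_neg)
open Literature.MathematicalPhysics.QuantumFieldTheory.Balaban1983to89.QGQInverse (Coercive)
open Literature.MathematicalPhysics.QuantumFieldTheory.Balaban1983to89.Beta.CoordCubePoincare
  (stepUp coercive_lap_blocks_of_charts)
open Finset

variable {d : ℕ}

/-! ## §1. Lattice geometry: `|e_μ|₁ = 1`, vectors of length one, at most `2d` nearest neighbours -/

/-- `|e_μ|₁ = 1` for the unit vector `e_μ = Pi.single μ 1` of `ℤ^d`.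
[cite: Balaban1984PropagatorsI, (1.18) p.20] [folklore] -/
theorem l1_single (μ : Fin d) : l1 (Pi.single μ (1 : ℤ) : Fin d → ℤ) = 1 := by
  classical
  unfold B12Sec2to5.l1
  rw [Finset.sum_eq_single μ]
  · simp
  · intro ν _ hν
    simp [Pi.single_eq_of_ne hν]
  · intro h
    exact absurd (Finset.mem_univ μ) h

/-- An integer vector with `|e|₁ = 1` is `± e_i` for some coordinate `i` (gen 98's `RemainderKernelGreenLattice.
single_of_l1_eq_one`, restated here to keep the imports on built modules).
[cite: Balaban1984PropagatorsI, (1.18) p.20] [folklore] -/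
theorem single_of_l1_eq_one {e : Fin d → ℤ} (he : l1 e = 1) :
    ∃ i : Fin d, e = Pi.single i 1 ∨ e = Pi.single i (-1) := by
  classical
  have hsumZ : ((∑ μ, |e μ| : ℤ) : ℝ) = 1 := by
    rw [← he]; unfold B12Sec2to5.l1; push_cast; rfl
  have hsum : ∑ μ, |e μ| = (1 : ℤ) := by exact_mod_cast hsumZ
  have hex : ∃ μ, e μ ≠ 0 := by
    by_contra h
    push Not at h
    have : ∑ μ, |e μ| = (0 : ℤ) := Finset.sum_eq_zero fun μ _ => by rw [h μ, abs_zero]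
    rw [this] at hsum
    exact zero_ne_one hsum
  obtain ⟨μ, hμ⟩ := hex
  have hsplit : ∑ ν, |e ν| = |e μ| + ∑ ν ∈ Finset.univ.erase μ, |e ν| :=
    (Finset.add_sum_erase Finset.univ (fun ν => |e ν|) (Finset.mem_univ μ)).symm
  have hrest0 : 0 ≤ ∑ ν ∈ Finset.univ.erase μ, |e ν| := Finset.sum_nonneg fun ν _ => abs_nonneg _
  have h1 : (1 : ℤ) ≤ |e μ| := Int.one_le_abs hμ
  have habs : |e μ| = 1 := by
    have : |e μ| ≤ 1 := by linarith [hsum, hsplit, hrest0]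
    exact le_antisymm this h1
  have hrest : ∑ ν ∈ Finset.univ.erase μ, |e ν| = 0 := by linarith [hsum, hsplit, habs]
  have hzero : ∀ ν, ν ≠ μ → e ν = 0 := by
    intro ν hν
    have h := (Finset.sum_eq_zero_iff_of_nonneg fun ν _ => abs_nonneg (e ν)).1 hrest ν
      (Finset.mem_erase.2 ⟨hν, Finset.mem_univ ν⟩)
    exact abs_eq_zero.1 h
  have hfun : e = Pi.single μ (e μ) := by
    funext ν
    by_cases hν : ν = μ
    · subst hν; rw [Pi.single_eq_same]
    · rw [Pi.single_eq_of_ne hν, hzero ν hν]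
  rcases (abs_eq (zero_le_one' ℤ)).1 habs with h | h
  · exact ⟨μ, Or.inl (by rw [hfun, h])⟩
  · exact ⟨μ, Or.inr (by rw [hfun, h])⟩

/-- **A site of `ℤ^d` has at most `2d` nearest neighbours in any finset**: `Σ_{y∈t} 1[|x−y|₁ = 1] ≤ 2d`.
[cite: Balaban1984PropagatorsI, (1.18) p.20] [folklore] -/
theorem sum_indicator_nn_le (x : Fin d → ℤ) (t : Finset (Fin d → ℤ)) :
    ∑ y ∈ t, (if l1 (x - y) = 1 then (1 : ℝ) else 0) ≤ 2 * d := by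
  classical
  rw [Finset.sum_boole]
  set F : Fin d × Bool → (Fin d → ℤ) := fun p => x - Pi.single p.1 (if p.2 then (1 : ℤ) else -1) with hF
  have hsub : t.filter (fun y => l1 (x - y) = 1) ⊆ Finset.univ.image F := by
    intro y hy
    obtain ⟨i, hi⟩ := single_of_l1_eq_one (Finset.mem_filter.1 hy).2
    rcases hi with h | h
    · exact Finset.mem_image.2 ⟨(i, true), Finset.mem_univ _, by simp [hF, ← h]⟩
    · exact Finset.mem_image.2 ⟨(i, false), Finset.mem_univ _, by simp [hF, ← h]⟩
  have hcard : (t.filter fun y => l1 (x - y) = 1).card ≤ 2 * d :=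
    calc (t.filter fun y => l1 (x - y) = 1).card ≤ (Finset.univ.image F).card := Finset.card_le_card hsub
      _ ≤ (Finset.univ : Finset (Fin d × Bool)).card := Finset.card_image_le
      _ = 2 * d := by simp [Fintype.card_prod, Fintype.card_bool, mul_comm]
  exact_mod_cast hcard

/-! ## §2. The chart `(b, y) ↦ L·b + y` of `ℤ^d` by blocks `b ∈ ℤ^d` and digits `y ∈ {0,…,n}^d`, `L = n + 1` -/

/-- Block of a charted point: `(L b_i + y_i) / L = b_i` (`0 ≤ y_i < L`).
[cite: Balaban1984PropagatorsI, (1.18) p.20] [folklore] -/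
theorem chart_ediv {n : ℕ} (b : ℤ) (y : Fin (n + 1)) :
    (((n + 1 : ℕ) : ℤ) * b + ((y : ℕ) : ℤ)) / ((n + 1 : ℕ) : ℤ) = b := by
  have hL : ((n + 1 : ℕ) : ℤ) ≠ 0 := by positivity
  rw [add_comm, Int.add_mul_ediv_left _ _ hL, Int.ediv_eq_zero_of_lt (by positivity) (by exact_mod_cast y.isLt),
    zero_add]

/-- Digit of a charted point: `(L b_i + y_i) % L = y_i`. [cite: Balaban1984PropagatorsI, (1.18) p.20] [folklore] -/
theorem chart_emod {n : ℕ} (b : ℤ) (y : Fin (n + 1)) :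
    (((n + 1 : ℕ) : ℤ) * b + ((y : ℕ) : ℤ)) % ((n + 1 : ℕ) : ℤ) = ((y : ℕ) : ℤ) := by
  rw [add_comm, Int.add_mul_emod_self_left, Int.emod_eq_of_lt (by positivity) (by exact_mod_cast y.isLt)]

/-- The chart is injective: block and digits are recovered by `/ L` and `% L`.
[cite: Balaban1984PropagatorsI, (1.18) p.20] [folklore] -/
theorem chart_injective {n : ℕ} {b b' : Fin d → ℤ} {y y' : Fin d → Fin (n + 1)}
    (h : (fun i => ((n + 1 : ℕ) : ℤ) * b i + ((y i : ℕ) : ℤ)) = fun i => ((n + 1 : ℕ) : ℤ) * b' i + ((y' i : ℕ) : ℤ)) :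
    b = b' ∧ y = y' := by
  constructor
  · funext i
    have hi := congrFun h i
    have := congrArg (· / ((n + 1 : ℕ) : ℤ)) hi
    simpa only [chart_ediv] using this
  · funext i
    have hi := congrFun h i
    have := congrArg (· % ((n + 1 : ℕ) : ℤ)) hi
    simp only [chart_emod] at this
    exact Fin.ext (by exact_mod_cast this)

/-- The chart is onto: `x = L·(x / L) + (x % L)` coordinatewise, with digits `x_i % L ∈ {0,…,n}`.
[cite: Balaban1984PropagatorsI, (1.18) p.20] [folklore] -/
theorem chart_surj {n : ℕ} (x : Fin d → ℤ) (i : Fin d) :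
    ((n + 1 : ℕ) : ℤ) * (x i / ((n + 1 : ℕ) : ℤ))
      + (((⟨(x i % ((n + 1 : ℕ) : ℤ)).toNat, by
          have h := Int.emod_lt_of_pos (x i) (b := ((n + 1 : ℕ) : ℤ)) (by positivity)
          have h0 := Int.emod_nonneg (x i) (b := ((n + 1 : ℕ) : ℤ)) (by positivity)
          omega⟩ : Fin (n + 1)) : ℕ) : ℤ) = x i := by
  have h0 := Int.emod_nonneg (x i) (b := ((n + 1 : ℕ) : ℤ)) (by positivity)
  simp only [Int.toNat_of_nonneg h0]
  exact Int.mul_ediv_add_emod (x i) _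

/-- One internal step of a block in the chart: for `y_μ ≠ n`, `L b + stepUp y μ = (L b + y) + e_μ`.
[cite: Balaban1984PropagatorsI, (1.18) p.20] [folklore] -/
theorem chart_stepUp {n : ℕ} (b : Fin d → ℤ) (y : Fin d → Fin (n + 1)) (μ : Fin d) (h : y μ ≠ Fin.last n) :
    (fun i => ((n + 1 : ℕ) : ℤ) * b i + ((stepUp y μ i : ℕ) : ℤ))
      = (fun i => ((n + 1 : ℕ) : ℤ) * b i + ((y i : ℕ) : ℤ)) + Pi.single μ 1 := by
  classical
  funext i
  simp only [Pi.add_apply, stepUp]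
  by_cases hi : i = μ
  · subst hi
    rw [Function.update_self, Pi.single_eq_same, Fin.val_add_one_of_lt (Fin.lt_last_iff_ne_last.2 h)]
    push_cast; ring
  · rw [Function.update_of_ne hi, Pi.single_eq_of_ne hi, add_zero]


/-! ## §3. The kernel `T = −Δ + a Q*Q` by its entries: range `L`, bounded entries, jointly `L`-periodic

`T(x,y) = 2d·1[x=y] − 1[|x−y|₁=1] + (a/L^d)·1[x, y in the same L-block]`, the block of `x` being `(x_i / L)_i`
(Euclidean division), `L = n + 1`: the unit-lattice form of `−Δ + a Q*Q` with `Q` the block average and `Q*Q` the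
orthogonal projection onto block-constant functions (`(Q*Q f)(x) = L^{−d} Σ_{x' ∈ B(x)} f(x')`).  A HYPOTHESIS `hT` on an
abstract `T`, so any definition of the operator plugs in. -/

section Kernel

variable {T : Kernel₂ d} {n : ℕ} {a : ℝ}

/-- `−Δ + a Q*Q` has range `L = n + 1` (nearest neighbours: range `1 ≤ L`; same block: `|x_i − y_i| ≤ n`).
[cite: Balaban1984PropagatorsI, (1.132) p.39] [folklore] -/
theorem hasRange_blockAvg
    (hT : ∀ x y, T x y = (if x = y then (2 * d : ℝ) else if l1 (x - y) = 1 then -1 else 0)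
      + (if (∀ i, x i / ((n + 1 : ℕ) : ℤ) = y i / ((n + 1 : ℕ) : ℤ)) then a / ((n + 1 : ℕ) : ℝ) ^ d else 0)) :
    HasRange T (n + 1) := by
  intro x y ⟨i, hi⟩
  have h2i : (2 : ℤ) ≤ |x i - y i| := by push_cast at hi; omega
  have hne : x ≠ y := by
    rintro rfl
    rw [sub_self, abs_zero] at h2i
    omega
  have hl : l1 (x - y) ≠ 1 := by
    have h2 : (2 : ℝ) ≤ l1 (x - y) := by
      have : (2 : ℝ) ≤ |((x - y) i : ℝ)| := by
        have h' : ((2 : ℤ) : ℝ) ≤ (|x i - y i| : ℤ) := by exact_mod_cast h2i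
        simpa [Pi.sub_apply, Int.cast_abs] using h'
      exact this.trans (abs_coord_le_l1 (x - y) i)
    linarith
  have hblk : ¬ (∀ j, x j / ((n + 1 : ℕ) : ℤ) = y j / ((n + 1 : ℕ) : ℤ)) := by
    intro h
    have hq := h i
    have hx := Int.mul_ediv_add_emod (x i) ((n + 1 : ℕ) : ℤ)
    have hy := Int.mul_ediv_add_emod (y i) ((n + 1 : ℕ) : ℤ)
    have hr1 := Int.emod_nonneg (x i) (b := ((n + 1 : ℕ) : ℤ)) (by positivity)
    have hr2 := Int.emod_lt_of_pos (x i) (b := ((n + 1 : ℕ) : ℤ)) (by positivity)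
    have hr3 := Int.emod_nonneg (y i) (b := ((n + 1 : ℕ) : ℤ)) (by positivity)
    have hr4 := Int.emod_lt_of_pos (y i) (b := ((n + 1 : ℕ) : ℤ)) (by positivity)
    have hdiff : x i - y i = x i % ((n + 1 : ℕ) : ℤ) - y i % ((n + 1 : ℕ) : ℤ) := by
      linear_combination (-1 : ℤ) * hx + hy + ((n + 1 : ℕ) : ℤ) * hq
    have hle : |x i - y i| ≤ n := by
      rw [hdiff, abs_le]; constructor <;> omega
    omega
  rw [hT, if_neg hne, if_neg hl, if_neg hblk, add_zero]

/-- Entry bound `|T(x,y)| ≤ 2d + 1 + a` (`a ≥ 0`). [cite: Balaban1984PropagatorsI, (1.132) p.39] [folklore] -/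
theorem abs_blockAvg_le
    (hT : ∀ x y, T x y = (if x = y then (2 * d : ℝ) else if l1 (x - y) = 1 then -1 else 0)
      + (if (∀ i, x i / ((n + 1 : ℕ) : ℤ) = y i / ((n + 1 : ℕ) : ℤ)) then a / ((n + 1 : ℕ) : ℝ) ^ d else 0))
    (ha : 0 ≤ a) (x y : Fin d → ℤ) : |T x y| ≤ 2 * d + 1 + a := by
  rw [hT]
  have h1 : |(if x = y then (2 * d : ℝ) else if l1 (x - y) = 1 then -1 else 0)| ≤ 2 * d + 1 := by
    split_ifs
    · rw [abs_of_nonneg (by positivity)]; linarith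
    · simp
    · simp; positivity
  have h2 : |(if (∀ i, x i / ((n + 1 : ℕ) : ℤ) = y i / ((n + 1 : ℕ) : ℤ)) then a / ((n + 1 : ℕ) : ℝ) ^ d else 0)|
      ≤ a := by
    split_ifs
    · rw [abs_of_nonneg (by positivity)]
      exact div_le_self ha (one_le_pow₀ (by exact_mod_cast Nat.succ_pos n))
    · simp [ha]
  exact (abs_add_le _ _).trans (by linarith)

/-- `−Δ + a Q*Q` is jointly `L`-periodic (covariant under the translations by `L·ℤ^d`, which preserve the blocks);
hence jointly `s`-periodic for every multiple `s` of `L` (`IsPeriodic₂.of_dvd`).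
[cite: Balaban1984PropagatorsI, (1.132) p.39] [folklore] -/
theorem isPeriodic₂_blockAvg
    (hT : ∀ x y, T x y = (if x = y then (2 * d : ℝ) else if l1 (x - y) = 1 then -1 else 0)
      + (if (∀ i, x i / ((n + 1 : ℕ) : ℤ) = y i / ((n + 1 : ℕ) : ℤ)) then a / ((n + 1 : ℕ) : ℝ) ^ d else 0)) :
    IsPeriodic₂ (n + 1) T := by
  intro x y m
  have hL : ((n + 1 : ℕ) : ℤ) ≠ 0 := by positivity
  rw [hT, hT x y]
  have e1 : (imageShift (n + 1) x m = imageShift (n + 1) y m) ↔ x = y := by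
    constructor
    · intro h; funext i
      have := congrFun h i
      simp only [imageShift_apply] at this
      linarith
    · rintro rfl; rfl
  have e2 : imageShift (n + 1) x m - imageShift (n + 1) y m = x - y := by
    funext i; simp only [Pi.sub_apply, imageShift_apply]; ring
  have e3 : (∀ i, imageShift (n + 1) x m i / ((n + 1 : ℕ) : ℤ) = imageShift (n + 1) y m i / ((n + 1 : ℕ) : ℤ))
      ↔ ∀ i, x i / ((n + 1 : ℕ) : ℤ) = y i / ((n + 1 : ℕ) : ℤ) := by
    refine forall_congr' fun i => ?_
    simp only [imageShift_apply]
    rw [Int.add_mul_ediv_left _ _ hL, Int.add_mul_ediv_left _ _ hL]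
    exact add_left_inj (m i)
  simp only [e1, e2, e3]

/-- NON-VACUITY of the entries hypothesis `hT`: the explicit kernel inhabits it (by `rfl`), for every `n`, `a`.
[cite: Balaban1984PropagatorsI, (1.132) p.39] [folklore] -/
theorem exists_blockAvg (d n : ℕ) (a : ℝ) : ∃ T : Kernel₂ d, ∀ x y,
    T x y = (if x = y then (2 * d : ℝ) else if l1 (x - y) = 1 then -1 else 0)
      + (if (∀ i, x i / ((n + 1 : ℕ) : ℤ) = y i / ((n + 1 : ℕ) : ℤ)) then a / ((n + 1 : ℕ) : ℝ) ^ d else 0) :=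
  ⟨fun x y => (if x = y then (2 * d : ℝ) else if l1 (x - y) = 1 then -1 else 0)
      + (if (∀ i, x i / ((n + 1 : ℕ) : ℤ) = y i / ((n + 1 : ℕ) : ℤ)) then a / ((n + 1 : ℕ) : ℝ) ^ d else 0),
    fun _ _ => rfl⟩

end Kernel


/-! ## §4. Coercivity on a charted patch of blocks: the blockwise Poincaré inequality

An abstract finite patch: sites `ι` charted injectively into `ℤ^d` by `Φ`, grouped into blocks by `blk : ι → β`, each
block being a full cube `φ b : {0,…,n}^d → ι` whose internal steps are lattice steps of `Φ` and whose label is read by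
Euclidean division of `Φ` by `L = n + 1`.  On such a patch the quadratic form of `T` (entries pulled back by `Φ`)
dominates `min(2∕(n(n+1)), a)·‖ω‖²`: the Laplacian part of `T` restricted to the patch is the graph Laplacian of the
induced nearest-neighbour graph PLUS a non-negative boundary diagonal (a site has at most `2d` neighbours), the block
part is `a Σ_b |b| (avg_b ω)²`, and `CoordCubePoincare.coercive_lap_blocks_of_charts` (Poincaré constant `n(n+1)/2` per
cube, conductance `1` on the internal steps) does the rest. -/

section Charted

variable {T : Kernel₂ d} {n : ℕ} {a : ℝ}

/-- **COERCIVITY OF `−Δ + a Q*Q` ON A CHARTED PATCH OF FULL BLOCKS.**  For `T` with the entries of `−Δ + a Q*Q`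
(`L = n + 1 ≥ 2`, `a ≥ 0`), a finite type `ι` injected into `ℤ^d` by `Φ`, blocks `blk : ι → β` detected by Euclidean
division of `Φ` by `L`, and full-cube charts `φ b` whose internal steps are unit lattice steps of `Φ`:
`min(2∕(n(n+1)), a) · Σ_j ω_j² ≤ Σ_{j,k} ω_j T(Φ j, Φ k) ω_k` for every `ω : ι → ℝ`.
[cite: Balaban1984PropagatorsI, (1.132) p.39] [folklore] -/
theorem form_lower_of_charts {ι β : Type*} [Fintype ι] [DecidableEq ι] [Fintype β] [DecidableEq β]
    (hT : ∀ x y, T x y = (if x = y then (2 * d : ℝ) else if l1 (x - y) = 1 then -1 else 0)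
      + (if (∀ i, x i / ((n + 1 : ℕ) : ℤ) = y i / ((n + 1 : ℕ) : ℤ)) then a / ((n + 1 : ℕ) : ℝ) ^ d else 0))
    (ha : 0 ≤ a) (hn : 1 ≤ n)
    (Φ : ι → (Fin d → ℤ)) (hΦ : Function.Injective Φ) (blk : ι → β)
    (hblk : ∀ j k, (∀ i, Φ j i / ((n + 1 : ℕ) : ℤ) = Φ k i / ((n + 1 : ℕ) : ℤ)) ↔ blk j = blk k)
    (φ : β → (Fin d → Fin (n + 1)) → ι) (hφblk : ∀ b y, blk (φ b y) = b)
    (hφinj : ∀ b, Function.Injective (φ b)) (hφsurj : ∀ i, ∃ y, φ (blk i) y = i)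
    (hstep : ∀ b y μ, y μ ≠ Fin.last n → Φ (φ b (stepUp y μ)) = Φ (φ b y) + Pi.single μ 1)
    (ω : ι → ℝ) :
    min (2 / ((n : ℝ) * (n + 1))) a * ∑ j, ω j ^ 2 ≤ ∑ j, ∑ k, ω j * T (Φ j) (Φ k) * ω k := by
  classical
  -- (1) the induced nearest-neighbour conductance
  set c : ι → ι → ℝ := fun j k => if l1 (Φ j - Φ k) = 1 then 1 else 0 with hc
  have hcs : ∀ j k, c j k = c k j := fun j k => by
    simp only [hc, l1_sub_comm (Φ j) (Φ k)]
  have hc0 : ∀ j k, 0 ≤ c j k := fun j k => by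
    simp only [hc]; split_ifs <;> norm_num
  have hcjj : ∀ j, c j j = 0 := fun j => by
    have : l1 (Φ j - Φ j) ≠ 1 := by rw [sub_self]; simp [B12Sec2to5.l1]
    simp only [hc, this, if_false]
  -- (2) degree bound: at most `2d` neighbours inside the patch
  have hdeg : ∀ j, ∑ l, c j l ≤ 2 * d := by
    intro j
    have h := sum_indicator_nn_le (Φ j) (Finset.univ.image Φ)
    rwa [Finset.sum_image fun x _ y _ hxy => hΦ hxy] at h
  -- (3) the bond system: ordered pairs `(j, k)` with `Φ k = Φ j + e_μ`
  have hγ : ∀ q : {q : ι × ι // ∃ μ : Fin d, Φ q.2 = Φ q.1 + Pi.single μ 1}, (1 : ℝ) ≤ c q.1.1 q.1.2 := by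
    rintro ⟨⟨j, k⟩, μ, hμ⟩
    have h1 : l1 (Φ j - Φ k) = 1 := by
      have : Φ j - Φ k = -Pi.single μ 1 := by rw [hμ]; abel
      rw [this, l1_neg, l1_single]
    simp only [hc, h1, if_true, le_refl]
  have hinj : Function.Injective
      fun q : {q : ι × ι // ∃ μ : Fin d, Φ q.2 = Φ q.1 + Pi.single μ 1} => (q.1.1, q.1.2) := by
    rintro ⟨⟨j, k⟩, _⟩ ⟨⟨j', k'⟩, _⟩ h
    simp only [Prod.mk.injEq] at h
    obtain ⟨rfl, rfl⟩ := h
    rfl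
  have hanti : ∀ q q' : {q : ι × ι // ∃ μ : Fin d, Φ q.2 = Φ q.1 + Pi.single μ 1},
      (q.1.1, q.1.2) ≠ (q'.1.2, q'.1.1) := by
    rintro ⟨⟨j, k⟩, μ, hμ⟩ ⟨⟨j', k'⟩, μ', hμ'⟩ h
    simp only [Prod.mk.injEq] at h
    obtain ⟨rfl, rfl⟩ := h
    have h1 := congrFun hμ μ
    have h2 := congrFun hμ' μ
    simp only [Pi.add_apply, Pi.single_apply] at h1 h2
    split_ifs at h1 h2 <;> omega
  -- (4) the internal-step listing of each block
  have h0 : (0 : Fin (n + 1)) ≠ Fin.last n := by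
    intro h
    have := congrArg Fin.val h
    simp at this
    omega
  have hupd : ∀ (y : Fin d → Fin (n + 1)) (μ : Fin d), Function.update y μ 0 μ ≠ Fin.last n := fun y μ => by
    rw [Function.update_self]; exact h0
  set ψ : β → Fin d → (Fin d → Fin (n + 1)) → {q : ι × ι // ∃ μ : Fin d, Φ q.2 = Φ q.1 + Pi.single μ 1} :=
    fun b μ y => if h : y μ ≠ Fin.last n then ⟨(φ b y, φ b (stepUp y μ)), μ, hstep b y μ h⟩
      else ⟨(φ b (Function.update y μ 0), φ b (stepUp (Function.update y μ 0) μ)), μ,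
        hstep b _ μ (hupd y μ)⟩ with hψ
  have hψsrc : ∀ b μ y, y μ ≠ Fin.last n → (ψ b μ y).1.1 = φ b y := fun b μ y h => by
    simp only [hψ, dif_pos h]
  have hψtgt : ∀ b μ y, y μ ≠ Fin.last n → (ψ b μ y).1.2 = φ b (stepUp y μ) := fun b μ y h => by
    simp only [hψ, dif_pos h]
  have hψinj : ∀ b, Set.InjOn (fun p : Fin d × (Fin d → Fin (n + 1)) => ψ b p.1 p.2)
      {p | p.2 p.1 ≠ Fin.last n} := by
    intro b p hp p' hp' h
    simp only [Set.mem_setOf_eq] at hp hp'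
    have h' := congrArg (fun q : {q : ι × ι // ∃ μ : Fin d, Φ q.2 = Φ q.1 + Pi.single μ 1} => q.1) h
    simp only [hψ, dif_pos hp, dif_pos hp', Prod.mk.injEq] at h'
    have hy : p.2 = p'.2 := hφinj b h'.1
    have hs : stepUp p.2 p.1 = stepUp p.2 p'.1 := by
      have := hφinj b h'.2
      rwa [← hy] at this
    have hμ : p.1 = p'.1 := by
      by_contra hne
      have h3 := congrFun hs p.1
      simp only [stepUp, Function.update_self, Function.update_of_ne hne] at h3
      have h4 : (1 : Fin (n + 1)) = 0 := by
        have := congrArg (fun z => z - p.2 p.1) h3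
        simpa using this
      rw [Fin.one_eq_zero_iff] at h4
      omega
    exact Prod.ext hμ hy
  -- (5) the matrix: `T` pulled back, minus the non-negative boundary diagonal
  set H : Matrix ι ι ℝ := Matrix.of fun j k => T (Φ j) (Φ k) - (if j = k then 2 * d - ∑ l, c j l else 0)
    with hH
  have hcard : ∀ b : β, ((Finset.univ.filter fun i : ι => blk i = b).card : ℝ) = ((n + 1 : ℕ) : ℝ) ^ d := by
    intro b
    have : Finset.univ.filter (fun i : ι => blk i = b) = Finset.univ.image (φ b) := by
      ext i
      simp only [Finset.mem_filter, Finset.mem_univ, true_and, Finset.mem_image]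
      constructor
      · rintro rfl; exact hφsurj i
      · rintro ⟨y, rfl⟩; exact hφblk b y
    rw [this, Finset.card_image_of_injective _ (hφinj b), Finset.card_univ, Fintype.card_fun, Fintype.card_fin,
      Fintype.card_fin]
    push_cast; ring
  have hHeq : ∀ j k, H j k = CombesThomasForm.lap c j k
      + ∑ b, a / ((Finset.univ.filter fun i : ι => blk i = b).card : ℝ)
          * ((if blk j = b then (1 : ℝ) else 0) * (if blk k = b then (1 : ℝ) else 0)) := by
    intro j k
    have hblock : ∑ b, a / ((Finset.univ.filter fun i : ι => blk i = b).card : ℝ)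
          * ((if blk j = b then (1 : ℝ) else 0) * (if blk k = b then (1 : ℝ) else 0))
        = if blk j = blk k then a / ((n + 1 : ℕ) : ℝ) ^ d else 0 := by
      simp_rw [hcard]
      rw [Finset.sum_eq_single (blk j)]
      · by_cases h : blk j = blk k
        · simp [h]
        · have h' : ¬ blk k = blk j := fun e => h e.symm
          simp [h, h']
      · intro b _ hb
        have : ¬ blk j = b := fun e => hb e.symm
        simp [this]
      · intro h; exact absurd (Finset.mem_univ _) h
    rw [hblock, hH, Matrix.of_apply, CombesThomasForm.lap_apply, hT]
    by_cases hjk : j = k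
    · subst hjk
      simp only [if_true, implies_true, hcjj]
      ring
    · have hΦjk : Φ j ≠ Φ k := fun e => hjk (hΦ e)
      have hcjk : c j k = if l1 (Φ j - Φ k) = 1 then 1 else 0 := rfl
      by_cases hb : blk j = blk k
      · have hb' : ∀ i, Φ j i / ((n + 1 : ℕ) : ℤ) = Φ k i / ((n + 1 : ℕ) : ℤ) := (hblk j k).2 hb
        rw [if_neg hjk, if_neg hΦjk, if_pos hb', if_pos hb, if_neg hjk, hcjk]
        split_ifs <;> ring
      · have hb' : ¬ ∀ i, Φ j i / ((n + 1 : ℕ) : ℤ) = Φ k i / ((n + 1 : ℕ) : ℤ) := fun e => hb ((hblk j k).1 e)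
        rw [if_neg hjk, if_neg hΦjk, if_neg hb', if_neg hb, if_neg hjk, hcjk]
        split_ifs <;> ring
  -- (6) the blockwise Poincaré inequality
  have hn0 : (0 : ℝ) < n := by exact_mod_cast hn
  have hP : (0 : ℝ) < (n : ℝ) * (n + 1) / 2 := by positivity
  have key := coercive_lap_blocks_of_charts c hcs hc0 blk
    (fun q : {q : ι × ι // ∃ μ : Fin d, Φ q.2 = Φ q.1 + Pi.single μ 1} => q.1.1) (fun q => q.1.2)
    1 a ((n : ℝ) * (n + 1) / 2) zero_le_one ha hP hγ hinj hanti n d le_rfl φ hφblk hφinj hφsurj ψ hψsrc hψtgt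
    hψinj H hHeq ω
  -- (7) read the two sides
  have hmin : min (2 / ((n : ℝ) * (n + 1))) a = min (1 / ((n : ℝ) * (n + 1) / 2)) a := by
    congr 1
    field_simp
  have hdot : ω ⬝ᵥ ω = ∑ j, ω j ^ 2 := by
    simp only [dotProduct, pow_two]
  have hform : ω ⬝ᵥ H.mulVec ω
      = ∑ j, ∑ k, ω j * T (Φ j) (Φ k) * ω k - ∑ j, (2 * d - ∑ l, c j l) * ω j ^ 2 := by
    rw [← Finset.sum_sub_distrib]
    simp only [dotProduct, Matrix.mulVec, hH, Matrix.of_apply]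
    refine Finset.sum_congr rfl fun j _ => ?_
    have hrow : ∑ k, (T (Φ j) (Φ k) - if j = k then 2 * (d : ℝ) - ∑ l, c j l else 0) * ω k
        = ∑ k, T (Φ j) (Φ k) * ω k - (2 * d - ∑ l, c j l) * ω j := by
      simp only [sub_mul, Finset.sum_sub_distrib, ite_mul, zero_mul, Finset.sum_ite_eq, Finset.mem_univ, if_true]
    rw [hrow, mul_sub, Finset.mul_sum]
    congr 1
    · exact Finset.sum_congr rfl fun k _ => by ring
    · ring
  have hbdry : 0 ≤ ∑ j, (2 * d - ∑ l, c j l) * ω j ^ 2 :=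
    Finset.sum_nonneg fun j _ => mul_nonneg (sub_nonneg.2 (hdeg j)) (sq_nonneg _)
  rw [hmin, ← hdot]
  linarith [key, hform, hbdry]

end Charted


/-! ## §5. Coercivity of every finite principal submatrix of `−Δ + a Q*Q` on `ℤ^d`

Any finset `t ⊂ ℤ^d` lies in the (finite) union of the blocks it meets; extending a test function by zero to that
union of full blocks changes neither side of the inequality, and on a union of full blocks §4 applies with the
chart `(b, y) ↦ L·b + y` of §2. -/

section Lattice

variable {T : Kernel₂ d} {n : ℕ} {a : ℝ}

/-- **THE FORM INEQUALITY ON `ℤ^d`.**  For `T = −Δ + a Q*Q` (blocks of side `L = n + 1 ≥ 2`, `a ≥ 0`), every finset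
`t ⊂ ℤ^d` and every `f`: `min(2∕(n(n+1)), a) · Σ_{x∈t} f(x)² ≤ Σ_{x,y∈t} f(x) T(x,y) f(y)` — the quadratic form of
EVERY finite principal submatrix is bounded below by the blockwise Poincaré constant, uniformly in `t`.
[cite: Balaban1984PropagatorsI, (1.132) p.39] [folklore] -/
theorem form_blockAvg
    (hT : ∀ x y, T x y = (if x = y then (2 * d : ℝ) else if l1 (x - y) = 1 then -1 else 0)
      + (if (∀ i, x i / ((n + 1 : ℕ) : ℤ) = y i / ((n + 1 : ℕ) : ℤ)) then a / ((n + 1 : ℕ) : ℝ) ^ d else 0))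
    (ha : 0 ≤ a) (hn : 1 ≤ n) (t : Finset (Fin d → ℤ)) (f : (Fin d → ℤ) → ℝ) :
    min (2 / ((n : ℝ) * (n + 1))) a * ∑ x ∈ t, f x ^ 2 ≤ ∑ x ∈ t, ∑ y ∈ t, f x * T x y * f y := by
  classical
  -- the blocks met by `t` and the chart of their union
  set B : Finset (Fin d → ℤ) := t.image fun x i => x i / ((n + 1 : ℕ) : ℤ) with hB
  set Φ : ↥B × (Fin d → Fin (n + 1)) → (Fin d → ℤ) :=
    fun p i => ((n + 1 : ℕ) : ℤ) * (p.1 : Fin d → ℤ) i + ((p.2 i : ℕ) : ℤ) with hΦ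
  have hΦinj : Function.Injective Φ := by
    rintro ⟨b, y⟩ ⟨b', y'⟩ h
    obtain ⟨hb, hy⟩ := chart_injective (n := n) (b := (b : Fin d → ℤ)) (b' := (b' : Fin d → ℤ)) h
    exact Prod.ext (Subtype.ext hb) hy
  have hblk : ∀ j k : ↥B × (Fin d → Fin (n + 1)),
      (∀ i, Φ j i / ((n + 1 : ℕ) : ℤ) = Φ k i / ((n + 1 : ℕ) : ℤ)) ↔ j.1 = k.1 := by
    intro j k
    simp only [hΦ, chart_ediv]
    rw [Subtype.ext_iff, funext_iff]
  have hstep : ∀ (b : ↥B) (y : Fin d → Fin (n + 1)) (μ : Fin d), y μ ≠ Fin.last n →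
      Φ (b, stepUp y μ) = Φ (b, y) + Pi.single μ 1 := fun b y μ h => chart_stepUp _ y μ h
  -- `t` lies in the image of the chart
  have ht : t ⊆ Finset.univ.image Φ := by
    intro x hx
    refine Finset.mem_image.2 ⟨(⟨fun i => x i / ((n + 1 : ℕ) : ℤ), Finset.mem_image.2 ⟨x, hx, rfl⟩⟩,
      fun i => ⟨(x i % ((n + 1 : ℕ) : ℤ)).toNat, by
        have h := Int.emod_lt_of_pos (x i) (b := ((n + 1 : ℕ) : ℤ)) (by positivity)
        have h0 := Int.emod_nonneg (x i) (b := ((n + 1 : ℕ) : ℤ)) (by positivity)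
        omega⟩), Finset.mem_univ _, ?_⟩
    funext i
    exact chart_surj x i
  -- extend `f` by zero off `t`
  set g : (Fin d → ℤ) → ℝ := fun x => if x ∈ t then f x else 0 with hg
  have hg1 : ∑ x ∈ t, f x ^ 2 = ∑ x ∈ Finset.univ.image Φ, g x ^ 2 := by
    rw [← Finset.sum_subset ht (f := fun x => g x ^ 2) (fun x _ hx => by simp [hg, hx])]
    exact Finset.sum_congr rfl fun x hx => by simp [hg, hx]
  have hg2 : ∑ x ∈ t, ∑ y ∈ t, f x * T x y * f y
      = ∑ x ∈ Finset.univ.image Φ, ∑ y ∈ Finset.univ.image Φ, g x * T x y * g y := by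
    rw [← Finset.sum_subset ht (f := fun x => ∑ y ∈ Finset.univ.image Φ, g x * T x y * g y)
      (fun x _ hx => by simp [hg, hx])]
    refine Finset.sum_congr rfl fun x hx => ?_
    rw [← Finset.sum_subset ht (f := fun y => g x * T x y * g y) (fun y _ hy => by simp [hg, hy])]
    exact Finset.sum_congr rfl fun y hy => by simp [hg, hx, hy]
  rw [hg1, hg2, Finset.sum_image fun x _ y _ hxy => hΦinj hxy]
  simp_rw [Finset.sum_image fun x _ y _ hxy => hΦinj hxy]
  have key := form_lower_of_charts hT ha hn Φ hΦinj Prod.fst hblk (fun b y => (b, y)) (fun _ _ => rfl)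
    (fun b => Prod.mk_right_injective b) (fun i => ⟨i.2, rfl⟩) hstep (fun j => g (Φ j))
  simpa only using key

/-- **EVERY FINITE PRINCIPAL SUBMATRIX OF `−Δ + a Q*Q` IS `min(2∕(n(n+1)), a)`-COERCIVE** — the hypothesis `hco`
of gen 98's smallness-free Combes–Thomas theorem `RemainderKernelGreenCoercive.exists_green_of_coercive_hasRange`,
for Bałaban's one-step block-averaging operator on the unit lattice. [cite: Balaban1984PropagatorsI, (1.132) p.39]
[folklore] -/
theorem coercive_blockAvg
    (hT : ∀ x y, T x y = (if x = y then (2 * d : ℝ) else if l1 (x - y) = 1 then -1 else 0)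
      + (if (∀ i, x i / ((n + 1 : ℕ) : ℤ) = y i / ((n + 1 : ℕ) : ℤ)) then a / ((n + 1 : ℕ) : ℝ) ^ d else 0))
    (ha : 0 ≤ a) (hn : 1 ≤ n) (s : Finset (Fin d → ℤ)) :
    Coercive (Matrix.of fun i j : ↥s => T i j) (min (2 / ((n : ℝ) * (n + 1))) a) := by
  classical
  intro v
  set f : (Fin d → ℤ) → ℝ := fun x => if hx : x ∈ s then v ⟨x, hx⟩ else 0 with hf
  have hfv : ∀ i : ↥s, f i = v i := fun i => by
    have hi : (i : Fin d → ℤ) ∈ s := i.2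
    simp only [hf, hi, ↓reduceDIte, Subtype.coe_eta]
  have h1 : v ⬝ᵥ v = ∑ x ∈ s, f x ^ 2 := by
    rw [← Finset.sum_coe_sort s (fun x => f x ^ 2)]
    simp only [dotProduct, hfv, pow_two]
  have h2 : v ⬝ᵥ (Matrix.of (fun i j : ↥s => T i j)).mulVec v = ∑ x ∈ s, ∑ y ∈ s, f x * T x y * f y := by
    rw [← Finset.sum_coe_sort s (fun x => ∑ y ∈ s, f x * T x y * f y)]
    simp only [dotProduct, Matrix.mulVec, Matrix.of_apply]
    refine Finset.sum_congr rfl fun i _ => ?_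
    rw [← Finset.sum_coe_sort s (fun y => f i * T i y * f y), Finset.mul_sum]
    exact Finset.sum_congr rfl fun j _ => by rw [hfv i, hfv j]; ring
  rw [h1, h2]
  exact form_blockAvg hT ha hn s f

/-- The coercivity constant is positive for `a > 0`, `n ≥ 1`. [cite: Balaban1984PropagatorsI, (1.132) p.39] [folklore] -/
theorem coerciveConst_pos {n : ℕ} {a : ℝ} (ha : 0 < a) (hn : 1 ≤ n) : 0 < min (2 / ((n : ℝ) * (n + 1))) a := by
  have hn0 : (0 : ℝ) < n := by exact_mod_cast hn
  exact lt_min (by positivity) ha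

/-- **MESH-UNIFORM FORM.**  In Bałaban's `η = 1∕L` scaling — Laplacian `× η^{−2} = L²`, block coefficient `a_η = L²·a` —
the operator `L²·T = −Δ^η + a_η Q*Q` satisfies `min(2, a_η)·Σ_{x∈t} f(x)² ≤ Σ_{x,y∈t} f(x)(L²T)(x,y)f(y)` for EVERY finset
`t` and every `f`: ALL finite principal submatrices are `min(2, a_η)`-coercive, UNIFORMLY IN THE MESH and in the region
(`L²·2∕(n(n+1)) = 2L∕n ≥ 2`) — pv23's torus constant `TorusG0Decay.coercive_torus`, here on arbitrary finite patches of
`ℤ^d`.  (The decay RATE of the Green's function obtained downstream is NOT mesh-uniform; see the module docstring.)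
[cite: Balaban1984PropagatorsI, (1.132) p.39] [folklore] -/
theorem form_blockAvg_meshUniform
    (hT : ∀ x y, T x y = (if x = y then (2 * d : ℝ) else if l1 (x - y) = 1 then -1 else 0)
      + (if (∀ i, x i / ((n + 1 : ℕ) : ℤ) = y i / ((n + 1 : ℕ) : ℤ)) then a / ((n + 1 : ℕ) : ℝ) ^ d else 0))
    (ha : 0 ≤ a) (hn : 1 ≤ n) (t : Finset (Fin d → ℤ)) (f : (Fin d → ℤ) → ℝ) :
    min 2 (((n + 1 : ℕ) : ℝ) ^ 2 * a) * ∑ x ∈ t, f x ^ 2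
      ≤ ((n + 1 : ℕ) : ℝ) ^ 2 * ∑ x ∈ t, ∑ y ∈ t, f x * T x y * f y := by
  have key := form_blockAvg hT ha hn t f
  have hn0 : (0 : ℝ) < n := by exact_mod_cast hn
  have hL : (0 : ℝ) < ((n + 1 : ℕ) : ℝ) ^ 2 := by positivity
  have hS : 0 ≤ ∑ x ∈ t, f x ^ 2 := Finset.sum_nonneg fun x _ => sq_nonneg _
  -- `min 2 (L² a) ≤ L² · min (2∕(n(n+1))) a`
  have hmin : min 2 (((n + 1 : ℕ) : ℝ) ^ 2 * a) ≤ ((n + 1 : ℕ) : ℝ) ^ 2 * min (2 / ((n : ℝ) * (n + 1))) a := by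
    rcases le_total (2 / ((n : ℝ) * (n + 1))) a with h | h
    · rw [min_eq_left h]
      have h2 : (2 : ℝ) ≤ ((n + 1 : ℕ) : ℝ) ^ 2 * (2 / ((n : ℝ) * (n + 1))) := by
        rw [← sub_nonneg]
        have : ((n + 1 : ℕ) : ℝ) ^ 2 * (2 / ((n : ℝ) * (n + 1))) - 2 = 2 / n := by
          push_cast; field_simp; ring
        rw [this]; positivity
      exact (min_le_left _ _).trans h2
    · rw [min_eq_right h]
      exact min_le_right _ _
  calc min 2 (((n + 1 : ℕ) : ℝ) ^ 2 * a) * ∑ x ∈ t, f x ^ 2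
      ≤ ((n + 1 : ℕ) : ℝ) ^ 2 * min (2 / ((n : ℝ) * (n + 1))) a * ∑ x ∈ t, f x ^ 2 :=
        mul_le_mul_of_nonneg_right hmin hS
    _ = ((n + 1 : ℕ) : ℝ) ^ 2 * (min (2 / ((n : ℝ) * (n + 1))) a * ∑ x ∈ t, f x ^ 2) := by ring
    _ ≤ ((n + 1 : ℕ) : ℝ) ^ 2 * ∑ x ∈ t, ∑ y ∈ t, f x * T x y * f y := mul_le_mul_of_nonneg_left key hL.le

/-- **THE BLOCK SIDE AS THE PARAMETER** (consumer form): for `L ≥ 2` and the entries written with `L`,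
`min(2∕((L−1)L), a)·Σ_{x∈t} f(x)² ≤ Σ_{x,y∈t} f(x)T(x,y)f(y)` for every finset `t` — `form_blockAvg` with `L = n + 1`.
[cite: Balaban1984PropagatorsI, (1.132) p.39] [folklore] -/
theorem form_blockAvg_side {L : ℕ} (hL : 2 ≤ L)
    (hT : ∀ x y, T x y = (if x = y then (2 * d : ℝ) else if l1 (x - y) = 1 then -1 else 0)
      + (if (∀ i, x i / ((L : ℕ) : ℤ) = y i / ((L : ℕ) : ℤ)) then a / ((L : ℕ) : ℝ) ^ d else 0))
    (ha : 0 ≤ a) (t : Finset (Fin d → ℤ)) (f : (Fin d → ℤ) → ℝ) :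
    min (2 / (((L : ℝ) - 1) * L)) a * ∑ x ∈ t, f x ^ 2 ≤ ∑ x ∈ t, ∑ y ∈ t, f x * T x y * f y := by
  obtain ⟨n, rfl⟩ : ∃ n, L = n + 1 := ⟨L - 1, by omega⟩
  have hn : 1 ≤ n := by omega
  have e : (((n + 1 : ℕ) : ℝ) - 1) * ((n + 1 : ℕ) : ℝ) = (n : ℝ) * (n + 1) := by push_cast; ring
  rw [e]
  exact form_blockAvg hT ha hn t f

/-- **EVERY FINITE PRINCIPAL SUBMATRIX IS `min(2∕((L−1)L), a)`-COERCIVE** — `coercive_blockAvg` with the block side `L ≥ 2`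
as the parameter. [cite: Balaban1984PropagatorsI, (1.132) p.39] [folklore] -/
theorem coercive_blockAvg_side {L : ℕ} (hL : 2 ≤ L)
    (hT : ∀ x y, T x y = (if x = y then (2 * d : ℝ) else if l1 (x - y) = 1 then -1 else 0)
      + (if (∀ i, x i / ((L : ℕ) : ℤ) = y i / ((L : ℕ) : ℤ)) then a / ((L : ℕ) : ℝ) ^ d else 0))
    (ha : 0 ≤ a) (s : Finset (Fin d → ℤ)) :
    Coercive (Matrix.of fun i j : ↥s => T i j) (min (2 / (((L : ℝ) - 1) * L)) a) := by
  obtain ⟨n, rfl⟩ : ∃ n, L = n + 1 := ⟨L - 1, by omega⟩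
  have hn : 1 ≤ n := by omega
  have e : (((n + 1 : ℕ) : ℝ) - 1) * ((n + 1 : ℕ) : ℝ) = (n : ℝ) * (n + 1) := by push_cast; ring
  rw [e]
  exact coercive_blockAvg hT ha hn s

/-- **THE MASSIVE BLOCK OPERATOR `−Δ + aQ*Q + m²`**: adding a mass term to the diagonal adds `m²` to the form
constant — `(min(2∕(n(n+1)), a) + m²)·Σ_{x∈t} f(x)² ≤ Σ_{x,y∈t} f(x)T′(x,y)f(y)` for every finset `t`.
[cite: Balaban1984PropagatorsI, (1.132) p.39] [folklore] -/
theorem form_blockAvg_massive {T' : Kernel₂ d} {m : ℝ}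
    (hT' : ∀ x y, T' x y = (if x = y then (2 * d : ℝ) else if l1 (x - y) = 1 then -1 else 0)
      + (if (∀ i, x i / ((n + 1 : ℕ) : ℤ) = y i / ((n + 1 : ℕ) : ℤ)) then a / ((n + 1 : ℕ) : ℝ) ^ d else 0)
      + (if x = y then m ^ 2 else 0))
    (ha : 0 ≤ a) (hn : 1 ≤ n) (t : Finset (Fin d → ℤ)) (f : (Fin d → ℤ) → ℝ) :
    (min (2 / ((n : ℝ) * (n + 1))) a + m ^ 2) * ∑ x ∈ t, f x ^ 2 ≤ ∑ x ∈ t, ∑ y ∈ t, f x * T' x y * f y := by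
  classical
  -- the massless part
  set T : Kernel₂ d := fun x y => T' x y - (if x = y then m ^ 2 else 0) with hTdef
  have hT : ∀ x y, T x y = (if x = y then (2 * d : ℝ) else if l1 (x - y) = 1 then -1 else 0)
      + (if (∀ i, x i / ((n + 1 : ℕ) : ℤ) = y i / ((n + 1 : ℕ) : ℤ)) then a / ((n + 1 : ℕ) : ℝ) ^ d else 0) := by
    intro x y; simp only [hTdef, hT' x y]; ring
  have key := form_blockAvg hT ha hn t f
  have hsplit : ∑ x ∈ t, ∑ y ∈ t, f x * T' x y * f y
      = ∑ x ∈ t, ∑ y ∈ t, f x * T x y * f y + m ^ 2 * ∑ x ∈ t, f x ^ 2 := by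
    have e : ∀ x y, T' x y = T x y + (if x = y then m ^ 2 else 0) := fun x y => by simp only [hTdef]; ring
    simp_rw [e, mul_add, add_mul, Finset.sum_add_distrib]
    congr 1
    rw [Finset.mul_sum]
    refine Finset.sum_congr rfl fun x hx => ?_
    simp only [mul_ite, mul_zero, ite_mul, zero_mul, Finset.sum_ite_eq, hx, if_true]
    ring
  rw [hsplit, add_mul]
  linarith [key]

end Lattice

end Literature.MathematicalPhysics.QuantumFieldTheory.Balaban1983to89.Beta.RemainderKernelBlockAveraging
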